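import Mathlib.Analysis.Calculus.UniformLimitsDeriv
import Literature.Barriers.CriticalPhenomena.RigorousRGSmallParameterCriticalPoint
import HarnessLib

/-!
# `RigorousRGSmallParameter` (Slade, Theorem 1.4.1): Proposition 8.2.2 as printed — the
# finite-volume limits along the critical curve — and the interchange of limit and derivative

Third companion ("proof architecture") file of
`Literature/Barriers/CriticalPhenomena/RigorousRGSmallParameter.lean`, one printed step below
`RigorousRGSmallParameterCriticalPoint.lean`. Source: G. Slade, *Critical exponents for
long-range `O(n)` models below the upper critical dimension*, CMP 358 (2018), arXiv:1611.06169
(held as TeX source; locators are section/theorem numbers of the published numbering).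

## Where this sits in the printed proof

`RigorousRGSmallParameterCriticalPoint.lean` reduced the barrier (= Theorem 1.4.1, first display,
`n ≥ 1`) to the named fact `LongRangePhi4.Slade2017_criticalCurve`: continuity of the critical
curve `ν* : [0,δ] → ℝ`, existence and size of the INFINITE-VOLUME susceptibility
`χ(g, ν*(m²))`, and — clause (c) there — DIFFERENTIABILITY OF THE INFINITE-VOLUME `ν ↦ χ(g,ν)`
at the points `ν*(m²)`, `m² ∈ (0,δ)`, with `-∂χ/∂ν(ν*) ≍ m^{-4+2γ̂ε/α±cε²}`.

What the renormalisation group actually outputs is one step more primitive. Proposition 8.2.2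
is a statement about limits of FINITE-VOLUME quantities: "For `n ≥ 0`, `m² ∈ (0,δ]`, and
`g ∈ [63/64 s̄, 65/64 s̄]`, the limits `χ̂ = lim_{N→∞} χ̂_N(m², ν₀ᶜ(m²))` and
`χ̂' = lim_{N→∞} χ̂'_N(m², ν₀ᶜ(m²))` exist and are given by `χ̂ = m⁻² - ν_∞m⁻⁴ = m⁻²(1 + O(s̄))`,
`χ̂' = -ν'_∞m⁻⁴ ≍ -m⁻⁴ m^{2γ̂ε/α+O(ε²)}`", where (§8.1, before Lemma 8.1.2) "for a function
`f = f(m²,g,ν₀)`, we write `f' = ∂_{ν₀} f(m²,g,ν₀ᶜ)`", and (§8.2, after Lemma 8.2.1) "We write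
`χ̂_N'` for the derivative of `χ̂_N` with respect to `ν₀` with `m², g` held fixed, and evaluated
at the critical `ν₀ᶜ(m²)`. By [`χ_N(g, ν₀ + m²) = χ̂_N(m², g, ν₀)`, §4.1 last display], this is
equal to the partial derivative of `χ_N` with respect to `ν`, evaluated at `ν₀ᶜ(m²) + m²`." The
passage to the derivative of the infinite-volume susceptibility is the last paragraph of the
proof of Proposition 8.2.2: "The convergence of `ν_N'` to `ν_∞'` is uniform on compact subsets
of `m² ∈ (0,δ)` by Lemma 8.1.4. Using this, it can be verified that the convergence of `χ̂_N'`
to its limiting value is uniform on compact subsets of `m² ∈ (0,δ)`. Therefore the limit and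
derivative can be interchanged, and `χ̂'` is in fact the derivative of `χ̂`." It is this
interchange — a theorem of real analysis, not of the renormalisation group — that the present
file proves, so that the trust base of the barrier becomes Proposition 8.2.2 as printed.

## What this file does

* `LongRangePhi4.Slade2017_prop822` — named fact (not proved; RG output): Corollaries
  7.2.4–7.2.5 (continuity of `ν*` on `[0,δ]`), Proposition 8.2.2 for the finite-volume
  susceptibility `χ_N(g,ν) = torusSusceptibilityPow d L N n α g ν` along `ν = ν*(m²)` — the
  limit `χ̂(m²)` with `|m²χ̂ - 1| ≤ Cs̄`; the `ν`-derivatives `χ̂'_N(m²)` of `χ_N(g,·)` at `ν*(m²)`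
  (their existence is presupposed by the printed notation and is part of the fact); their
  limits `Y(m²)` for `m² ∈ (0,δ]`; local uniformity of that convergence on `(0,δ)` (proof of
  Proposition 8.2.2); and the two-sided bounds of the first display after Remark 8.2.3 on
  `-Y(m²)` — with the quantifier prefix and the reading of the constants of `Slade2017_thm141`.
* `LongRangePhi4.Slade2017_criticalCurve_of_prop822` — PROVED: the interchange of the
  `N → ∞` limit with the `ν`-derivative. The infinite-volume `χ` is defined on the image of the
  curve through a choice of preimage (well defined by uniqueness of limits); with
  `[A,B] = ν*([0,δ])`, every point of `(A,B)` is `ν*(m²)` for some `m² ∈ (0,δ)` (intermediate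
  value theorem), the finite-volume derivatives converge locally uniformly on `(A,B)` (a compact
  `K ⊂ (A,B)` is covered by `ν*([a₁,a₂])` with `[a₁,a₂] ⊂ (0,δ)`), so Mathlib's
  `hasDerivAt_of_tendstoLocallyUniformlyOn` applies on `(A,B)`; finally `δ` is shrunk to a
  `δ' > 0` below which `ν*(m²) ∉ {A,B}`, which is possible because `χ̂(m²) ≥ 1/(2m²)` (from
  `|m²χ̂ - 1| ≤ Cs̄ ≤ ½`, after shrinking `ε₀` to `min ε₀ (1/(2cC))`) pins every preimage of a
  fixed value of `ν*` away from `0`.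
* `LongRangePhi4.Slade2017_thm141_of_prop822`, `rigorousRGSmallParameter_of_prop822` — the
  composites with the two sibling files (Theorem 8.3.1, then the final integration of §8.3).

After this file the unproved remainder of the barrier is `Slade2017_prop822`: Lemma 8.2.1
(`χ̂_N = m⁻² + m⁻⁴|Λ_N|⁻¹D²Z_N(0;𝟙,𝟙)/Z_N(0)`) fed with `Z_N = e^{-u_N|Λ|}(I_N + K_N)` and the flow
estimates (Theorems 6.3.1, 7.2.2, 7.3.1, Lemmas 8.1.1–8.1.4, Corollary 8.1.6) — the
renormalisation-group theory proper; and Corollaries 7.2.4–7.2.5 (continuity of the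
Bleher–Sinai critical initial condition). Not transcribed: `n = 0`; the formulas
`χ̂ = m⁻² - ν_∞m⁻⁴`, `χ̂' = -ν'_∞m⁻⁴`; `ν*(m²) = ν₀ᶜ(m²) + m²` with
`ν₀ᶜ = μ₀ - (n+2)C₀₀(m²)g`; `ν_c = -(n+2)C₀₀(0)g(1+O(g))`.
-/

noncomputable section

namespace Literature.Barriers.CriticalPhenomena

open Filter Set
open scoped _root_.Topology

namespace LongRangePhi4

/-! ### Proposition 8.2.2 as printed (named fact) -/

/-- **Slade, Proposition 8.2.2 (with its proof's local-uniformity sentence), the first display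
after Remark 8.2.3, and Corollaries 7.2.4–7.2.5: the finite-volume susceptibility and its
`ν`-derivative along the critical curve** (named fact, not proved here — it is the output of the
renormalisation-group flow of §5–§8.1 through Lemma 8.2.1). In the setting of Theorem 1.4.1 —
`d = 1,2,3`, `α = (d+ε)/2`, `L` large then `ε` small, `s̄ ≍ ε`, `g ∈ [63/64 s̄, 65/64 s̄]`, spin
case `n ≥ 1` — there are `δ > 0`, the critical curve `ν* : [0,δ] → ℝ`
(`ν*(m²) = ν₀ᶜ(m²) + m²`, §8.2), the limits `χ̂, Y : (0,δ] → ℝ` and the finite-volume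
derivatives `χ̂'_N : (0,δ] → ℝ` such that, with `χ_N(g,ν) = n⁻¹Σ_{x∈Λ_N}⟨φ₀·φ_x⟩_{g,ν,N}`
(`torusSusceptibilityPow d L N n α g ν`, §4.1):
(a) "`ν* : [0,δ] → ℝ` is continuous by Corollaries 7.2.4–7.2.5" (as used in the proof of
Theorem 8.3.1);
(b) for `m² ∈ (0,δ]`, "the limits `χ̂ = lim_{N→∞} χ̂_N(m², ν₀ᶜ(m²))` … exist", where
`χ̂_N(m², g, ν₀ᶜ(m²)) = χ_N(g, ν*(m²))` (§4.1, last display), "`χ̂ = m⁻²(1 + O(s̄))`", rendered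
`|m²χ̂ - 1| ≤ Cs̄`;
(c) for every `N` and `m² ∈ (0,δ]`, `χ̂'_N(m²)` is "the derivative of `χ̂_N` with respect to `ν₀`
with `m², g` held fixed, and evaluated at the critical `ν₀ᶜ(m²)`", which "is equal to the partial
derivative of `χ_N` with respect to `ν`, evaluated at `ν₀ᶜ(m²) + m²`" (§8.2, after Lemma 8.2.1);
(d) for `m² ∈ (0,δ]`, "the limits … `χ̂' = lim_{N→∞} χ̂'_N(m², ν₀ᶜ(m²))` exist" (`=: Y(m²)`);
(e) "the convergence of `χ̂_N'` to its limiting value is uniform on compact subsets of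
`m² ∈ (0,δ)`" (proof of Proposition 8.2.2), i.e. locally uniform on the open interval;
(f) "`χ̂' ≍ -m⁻⁴m^{2γ̂ε/α+O(ε²)}`", with the constants of the first display after Remark 8.2.3:
"there is a constant `c` such that `c⁻¹m^{-4+2γ̂ε/α+cε²} ≤ -χ̂' ≤ cm^{-4+2γ̂ε/α-cε²}`",
`γ̂ = (n+2)/(n+8)`, written in the variable `m²` (for `m² ≤ 1` the printed bounds imply these
with `C = c`).
Quantifier prefix and READING of the constants (`c` of `s̄ ≍ ε` and `C` uniform in `ε, g, m²`;
dependent on `d, n, L`; `δ` and the curve chosen after `g`) exactly as in `Slade2017_thm141` and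
`Slade2017_criticalCurve`; cf. the convention opening §8.1 ("for some positive `δ` and `c`, and
for all `ε ∈ (0,δ]`"). The existence of the finite-volume derivative in (c) is presupposed by
the printed notation `χ̂'_N` and is asserted here as part of the fact. Not transcribed: `n = 0`;
`χ̂ = m⁻² - ν_∞m⁻⁴`, `χ̂' = -ν'_∞m⁻⁴`; `ν₀ᶜ = μ₀ - (n+2)C₀₀(m²)g`.
[cite: Slade2017, Proposition 8.2.2 and its proof; first display after Remark 8.2.3; Corollaries 7.2.4–7.2.5; §4.1 last display] -/
def Slade2017_prop822 : Prop :=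
  ∀ (d n : ℕ), (d = 1 ∨ d = 2 ∨ d = 3) → 1 ≤ n →
    ∃ L₀ : ℕ, ∀ L : ℕ, L₀ ≤ L →
      ∃ ε₀ c C : ℝ, 0 < ε₀ ∧ 0 < c ∧ 0 < C ∧
        ∀ ε : ℝ, 0 < ε → ε < ε₀ →
          ∃ s : ℝ, ε / c ≤ s ∧ s ≤ c * ε ∧
            ∀ g : ℝ, 63 / 64 * s ≤ g → g ≤ 65 / 64 * s →
              ∃ δ : ℝ, 0 < δ ∧ ∃ νstar χhat Y : ℝ → ℝ, ∃ χN' : ℕ → ℝ → ℝ,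
                ContinuousOn νstar (Icc 0 δ) ∧
                (∀ m2 ∈ Ioc 0 δ,
                  HasSusceptibility d n L ((d + ε) / 2) g (νstar m2) (χhat m2) ∧
                    |m2 * χhat m2 - 1| ≤ C * s) ∧
                (∀ N : ℕ, ∀ m2 ∈ Ioc 0 δ,
                  HasDerivAt (fun ν => torusSusceptibilityPow d L N n ((d + ε) / 2) g ν)
                    (χN' N m2) (νstar m2)) ∧
                (∀ m2 ∈ Ioc 0 δ, Tendsto (fun N => χN' N m2) atTop (𝓝 (Y m2))) ∧
                TendstoLocallyUniformlyOn χN' Y atTop (Ioo 0 δ) ∧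
                (∀ m2 ∈ Ioc 0 δ,
                  C⁻¹ * m2 ^ (-2 + ((n : ℝ) + 2) / ((n : ℝ) + 8) * (ε / ((d + ε) / 2)) + C * ε ^ 2)
                      ≤ -Y m2 ∧
                  -Y m2 ≤ C * m2 ^ (-2 + ((n : ℝ) + 2) / ((n : ℝ) + 8) * (ε / ((d + ε) / 2))
                      - C * ε ^ 2))

/-! ### Two elementary lemmas on the critical curve -/

/-- If `m²χ̂(m²) ≥ K > 0` on `(0,δ]` and `χ̂` takes equal values at equal values of `ν*`, then a
given level `E` of `ν*` is not attained on `(0,t)` for some `t > 0`: a preimage `m₀` of `E`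
forces every other preimage `m²` to satisfy `K ≤ m²χ̂(m₀)`, i.e. `m² ≥ K/χ̂(m₀)`. (Used with
`E` the endpoints of `ν*([0,δ])`; this is the quantitative content of "the only point in `N` at
which `χ` can be infinite is `x_c`" in the proof of Theorem 8.3.1.) [folklore] -/
theorem exists_pos_forall_lt_apply_ne {νs χhat : ℝ → ℝ} {δ K : ℝ} (hδ : 0 < δ) (hK0 : 0 < K)
    (hK : ∀ m2 ∈ Ioc 0 δ, K ≤ m2 * χhat m2)
    (huniq : ∀ m2 ∈ Ioc 0 δ, ∀ m2' ∈ Ioc 0 δ, νs m2 = νs m2' → χhat m2 = χhat m2') (E : ℝ) :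
    ∃ t : ℝ, 0 < t ∧ ∀ m2 ∈ Ioc 0 δ, m2 < t → νs m2 ≠ E := by
  by_cases hE : ∃ m0 ∈ Ioc 0 δ, νs m0 = E
  · obtain ⟨m0, hm0, hm0E⟩ := hE
    have h0 := hK m0 hm0
    have hpos : 0 < χhat m0 := by
      by_contra hle
      push Not at hle
      have : m0 * χhat m0 ≤ 0 := mul_nonpos_of_nonneg_of_nonpos hm0.1.le hle
      linarith
    refine ⟨K / χhat m0, div_pos hK0 hpos, fun m2 hm2 hlt hE2 => ?_⟩
    have heq : χhat m2 = χhat m0 := huniq m2 hm2 m0 hm0 (hE2.trans hm0E.symm)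
    have h1 : K ≤ m2 * χhat m0 := by
      rw [← heq]
      exact hK m2 hm2
    have h2 : m2 * χhat m0 < K := (lt_div_iff₀ hpos).1 hlt
    linarith
  · push Not at hE
    exact ⟨δ, hδ, fun m2 hm2 _ => hE m2 hm2⟩

/-- Every point strictly between the endpoints of `ν*([0,δ]) = [A,B]` is attained by `ν*` on the
OPEN interval `(0,δ)` (intermediate value theorem between preimages of `A` and `B`). [folklore] -/
theorem exists_mem_Ioo_apply_eq_of_mem_Ioo {νs : ℝ → ℝ} {δ A B x : ℝ}
    (hνs : ContinuousOn νs (Icc 0 δ)) (hJ : νs '' Icc 0 δ = Icc A B) (hx : x ∈ Ioo A B) :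
    ∃ m2 ∈ Ioo 0 δ, νs m2 = x := by
  have hAB : A ≤ B := (hx.1.trans hx.2).le
  have hA : A ∈ νs '' Icc 0 δ := by
    rw [hJ]
    exact left_mem_Icc.2 hAB
  have hB : B ∈ νs '' Icc 0 δ := by
    rw [hJ]
    exact right_mem_Icc.2 hAB
  obtain ⟨a0, ha0, ha0A⟩ := hA
  obtain ⟨b0, hb0, hb0B⟩ := hB
  have hsub : uIcc a0 b0 ⊆ Icc 0 δ := ordConnected_Icc.uIcc_subset ha0 hb0
  have hx' : x ∈ uIcc (νs a0) (νs b0) := by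
    rw [ha0A, hb0B, uIcc_of_le hAB]
    exact ⟨hx.1.le, hx.2.le⟩
  obtain ⟨m2, hm2, hm2x⟩ := intermediate_value_uIcc (hνs.mono hsub) hx'
  have hma : m2 ≠ a0 := by
    rintro rfl
    rw [ha0A] at hm2x
    exact hx.1.ne hm2x
  have hmb : m2 ≠ b0 := by
    rintro rfl
    rw [hb0B] at hm2x
    exact hx.2.ne' hm2x
  refine ⟨m2, ?_, hm2x⟩
  rcases le_total a0 b0 with hab | hab
  · rw [uIcc_of_le hab] at hm2
    exact ⟨ha0.1.trans_lt (lt_of_le_of_ne hm2.1 (Ne.symm hma)),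
      (lt_of_le_of_ne hm2.2 hmb).trans_le hb0.2⟩
  · rw [uIcc_of_ge hab] at hm2
    exact ⟨hb0.1.trans_lt (lt_of_le_of_ne hm2.1 (Ne.symm hmb)),
      (lt_of_le_of_ne hm2.2 hma).trans_le ha0.2⟩

/-! ### The interchange of the infinite-volume limit with the `ν`-derivative -/

/-- **Slade, Proposition 8.2.2, last paragraph of the proof ("the limit and derivative can be
interchanged, and `χ̂'` is in fact the derivative of `χ̂`"), formalised**: the finite-volume
limits along the critical curve (`Slade2017_prop822`) imply the infinite-volume statement
`Slade2017_criticalCurve`. The infinite-volume susceptibility `χ` is defined on `ν*((0,δ])` by a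
choice of preimage (well defined: two preimages of the same `ν` give the same limit); on the
open interval `(A,B)`, `[A,B] = ν*([0,δ])`, the finite-volume `ν ↦ χ_N(g,ν)` converge pointwise
to `χ` and their derivatives converge locally uniformly (a compact `K ⊂ (A,B)` lies in
`ν*([a₁,a₂])` with `[a₁,a₂] ⊂ (0,δ)` by the intermediate value theorem, and on `[a₁,a₂]` the
convergence of `χ̂'_N` is uniform), so `hasDerivAt_of_tendstoLocallyUniformlyOn` gives
`χ' = Y` on `(A,B)`; and `δ` is shrunk to `δ'` so that `ν*((0,δ')) ⊂ (A,B)`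
(`exists_pos_forall_lt_apply_ne`, using `m²χ̂(m²) ≥ ½`). Constants: `ε₀' = min ε₀ (1/(2cC))`
(so that `Cs̄ ≤ ½`), `c' = c`, `C' = C`.
[cite: Slade2017, Proposition 8.2.2 (proof, last paragraph) and first display after Remark 8.2.3] -/
theorem Slade2017_criticalCurve_of_prop822 (h : Slade2017_prop822) : Slade2017_criticalCurve := by
  intro d n hd hn
  obtain ⟨L₀, hL₀⟩ := h d n hd hn
  refine ⟨L₀, fun L hL => ?_⟩
  obtain ⟨ε₀, c, C, hε₀, hc, hC, hmain⟩ := hL₀ L hL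
  clear hL₀
  refine ⟨min ε₀ (1 / (2 * c * C)), c, C, lt_min hε₀ (by positivity), hc, hC,
    fun ε hε hεlt => ?_⟩
  have hεε₀ : ε < ε₀ := hεlt.trans_le (min_le_left _ _)
  have hε2 : ε ≤ 1 / (2 * c * C) := (hεlt.trans_le (min_le_right _ _)).le
  obtain ⟨s, hs1, hs2, hg⟩ := hmain ε hε hεε₀
  clear hmain
  have hCs : C * s ≤ 1 / 2 := by
    calc C * s ≤ C * (c * ε) := mul_le_mul_of_nonneg_left hs2 hC.le
      _ ≤ C * (c * (1 / (2 * c * C))) := by gcongr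
      _ = 1 / 2 := by field_simp
  refine ⟨s, hs1, hs2, fun g hg1 hg2 => ?_⟩
  obtain ⟨δ, hδ, νs, χhat, Y, χN', hνs, hval, hder, hlim, hunif, hbd⟩ := hg g hg1 hg2
  clear hg
  -- uniqueness of limits / derivatives transfers along coincidences of the curve
  have huχ : ∀ m ∈ Ioc 0 δ, ∀ m' ∈ Ioc 0 δ, νs m = νs m' → χhat m = χhat m' := by
    intro m hm m' hm' hmm
    have h1 := (hval m hm).1
    have h2 := (hval m' hm').1
    rw [hmm] at h1
    exact tendsto_nhds_unique h1 h2
  have huD : ∀ N, ∀ m ∈ Ioc 0 δ, ∀ m' ∈ Ioc 0 δ, νs m = νs m' → χN' N m = χN' N m' := by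
    intro N m hm m' hm' hmm
    have h1 := hder N m hm
    have h2 := hder N m' hm'
    rw [hmm] at h1
    exact h1.unique h2
  have huY : ∀ m ∈ Ioc 0 δ, ∀ m' ∈ Ioc 0 δ, νs m = νs m' → Y m = Y m' := by
    intro m hm m' hm' hmm
    have h1 := hlim m hm
    have h2 := hlim m' hm'
    have : (fun N => χN' N m) = fun N => χN' N m' := funext fun N => huD N m hm m' hm' hmm
    rw [this] at h1
    exact tendsto_nhds_unique h1 h2
  -- `m² χ̂(m²) ≥ 1/2`
  have hK : ∀ m2 ∈ Ioc 0 δ, 1 / 2 ≤ m2 * χhat m2 := by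
    intro m2 hm
    have hh := abs_le.1 ((hval m2 hm).2.trans hCs)
    linarith [hh.1]
  -- the compact interval `ν*([0,δ]) = [A, B]`
  set A : ℝ := sInf (νs '' Icc 0 δ) with hA_def
  set B : ℝ := sSup (νs '' Icc 0 δ) with hB_def
  have hJ : νs '' Icc 0 δ = Icc A B := hνs.image_Icc hδ.le
  -- shrink `δ` so that the curve avoids `A` and `B`
  obtain ⟨tA, htA, htA'⟩ := exists_pos_forall_lt_apply_ne hδ one_half_pos hK huχ A
  obtain ⟨tB, htB, htB'⟩ := exists_pos_forall_lt_apply_ne hδ one_half_pos hK huχ B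
  set δ' : ℝ := min (δ / 2) (min tA tB) with hδ'_def
  have hδ'0 : 0 < δ' := lt_min (half_pos hδ) (lt_min htA htB)
  have hδ'δ : δ' < δ := (min_le_left _ _).trans_lt (half_lt_self hδ)
  have hδ'A : δ' ≤ tA := (min_le_right _ _).trans (min_le_left _ _)
  have hδ'B : δ' ≤ tB := (min_le_right _ _).trans (min_le_right _ _)
  have hinS : ∀ m2 ∈ Ioo 0 δ', νs m2 ∈ Ioo A B := by
    intro m2 hm
    have hmδ : m2 ∈ Ioc 0 δ := ⟨hm.1, (hm.2.trans hδ'δ).le⟩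
    have hmem : νs m2 ∈ Icc A B := by
      rw [← hJ]
      exact mem_image_of_mem νs ⟨hm.1.le, hmδ.2⟩
    exact ⟨lt_of_le_of_ne hmem.1 fun h => htA' m2 hmδ (hm.2.trans_le hδ'A) h.symm,
      lt_of_le_of_ne hmem.2 fun h => htB' m2 hmδ (hm.2.trans_le hδ'B) h⟩
  -- a preimage selector on `(0,δ]`
  obtain ⟨pre, hpre⟩ : ∃ pre : ℝ → ℝ, ∀ x, (∃ m ∈ Ioc 0 δ, νs m = x) →
      pre x ∈ Ioc 0 δ ∧ νs (pre x) = x := by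
    classical
    refine ⟨fun x => if hx : ∃ m ∈ Ioc 0 δ, νs m = x then hx.choose else δ, fun x hx => ?_⟩
    simp only [dif_pos hx]
    exact hx.choose_spec
  -- `(A,B)` is covered by the curve restricted to `(0,δ)`
  have hsI : ∀ x ∈ Ioo A B, ∃ m2 ∈ Ioo 0 δ, νs m2 = x := fun x hx =>
    exists_mem_Ioo_apply_eq_of_mem_Ioo hνs hJ hx
  have hsC : ∀ x ∈ Ioo A B, ∃ m ∈ Ioc 0 δ, νs m = x := fun x hx => by
    obtain ⟨m2, hm2, e⟩ := hsI x hx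
    exact ⟨m2, Ioo_subset_Ioc_self hm2, e⟩
  -- hypotheses of the uniform-limit theorem on `(A,B)`
  have hF : ∀ᶠ N in atTop, ∀ x ∈ Ioo A B,
      HasDerivAt (fun ν => torusSusceptibilityPow d L N n ((d + ε) / 2) g ν)
        (χN' N (pre x)) x := by
    refine Eventually.of_forall fun N x hx => ?_
    obtain ⟨hpm, hpx⟩ := hpre x (hsC x hx)
    have := hder N (pre x) hpm
    rwa [hpx] at this
  have hFG : ∀ x ∈ Ioo A B,
      Tendsto (fun N => torusSusceptibilityPow d L N n ((d + ε) / 2) g x) atTop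
        (𝓝 (χhat (pre x))) := by
    intro x hx
    obtain ⟨hpm, hpx⟩ := hpre x (hsC x hx)
    have := (hval (pre x) hpm).1
    rw [hpx] at this
    exact this
  have hF' : TendstoLocallyUniformlyOn (fun N x => χN' N (pre x)) (fun x => Y (pre x)) atTop
      (Ioo A B) := by
    rw [tendstoLocallyUniformlyOn_iff_forall_isCompact isOpen_Ioo]
    intro K hKs hK'
    rcases K.eq_empty_or_nonempty with rfl | hne
    · exact tendstoUniformlyOn_empty
    have hk₁ : sInf K ∈ K := hK'.sInf_mem hne
    have hk₂ : sSup K ∈ K := hK'.sSup_mem hne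
    obtain ⟨a₁, ha₁, ha₁k⟩ := hsI _ (hKs hk₁)
    obtain ⟨a₂, ha₂, ha₂k⟩ := hsI _ (hKs hk₂)
    have hK'sub : uIcc a₁ a₂ ⊆ Ioo 0 δ := ordConnected_Ioo.uIcc_subset ha₁ ha₂
    have hU : TendstoUniformlyOn χN' Y atTop (uIcc a₁ a₂) :=
      (tendstoLocallyUniformlyOn_iff_forall_isCompact isOpen_Ioo).1 hunif _ hK'sub
        isCompact_uIcc
    rw [Metric.tendstoUniformlyOn_iff] at hU ⊢
    intro e he
    filter_upwards [hU e he] with N hN y hy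
    have hy' : y ∈ uIcc (νs a₁) (νs a₂) := by
      rw [ha₁k, ha₂k]
      exact Icc_subset_uIcc ⟨csInf_le hK'.bddBelow hy, le_csSup hK'.bddAbove hy⟩
    obtain ⟨m2, hm2, hm2y⟩ :=
      intermediate_value_uIcc (hνs.mono (hK'sub.trans Ioo_subset_Icc_self)) hy'
    have hm2' : m2 ∈ Ioc 0 δ := Ioo_subset_Ioc_self (hK'sub hm2)
    obtain ⟨hpm, hpy⟩ := hpre y (hsC y (hKs hy))
    have e1 : χN' N (pre y) = χN' N m2 := huD N _ hpm _ hm2' (hpy.trans hm2y.symm)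
    have e2 : Y (pre y) = Y m2 := huY _ hpm _ hm2' (hpy.trans hm2y.symm)
    rw [e1, e2]
    exact hN m2 hm2
  have hDer : ∀ x ∈ Ioo A B, HasDerivAt (fun x => χhat (pre x)) (Y (pre x)) x := fun x hx =>
    hasDerivAt_of_tendstoLocallyUniformlyOn isOpen_Ioo hF' hF hFG hx
  -- assemble
  refine ⟨δ', hδ'0, νs, fun x => χhat (pre x), hνs.mono (Icc_subset_Icc le_rfl hδ'δ.le),
    ?_, ?_⟩
  · intro m2 hm
    have hmδ : m2 ∈ Ioc 0 δ := ⟨hm.1, hm.2.trans hδ'δ.le⟩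
    obtain ⟨hpm, hpx⟩ := hpre (νs m2) ⟨m2, hmδ, rfl⟩
    have e : χhat (pre (νs m2)) = χhat m2 := huχ _ hpm _ hmδ hpx
    simp only [e]
    exact hval m2 hmδ
  · intro m2 hm
    have hmδ : m2 ∈ Ioc 0 δ := ⟨hm.1, (hm.2.trans hδ'δ).le⟩
    obtain ⟨hpm, hpx⟩ := hpre (νs m2) ⟨m2, hmδ, rfl⟩
    have e : Y (pre (νs m2)) = Y m2 := huY _ hpm _ hmδ hpx
    refine ⟨Y m2, ?_, hbd m2 hmδ⟩
    have := hDer (νs m2) (hinS m2 hm)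
    rwa [e] at this

/-- Theorem 1.4.1, first display, `n ≥ 1` (`Slade2017_thm141`) from Proposition 8.2.2 as
printed: the interchange (this file), Theorem 8.3.1 (`RigorousRGSmallParameterCriticalPoint`),
and the final integration (`RigorousRGSmallParameterSladeReduction`).
[cite: Slade2017, §8.2–§8.3] -/
theorem Slade2017_thm141_of_prop822 (h : Slade2017_prop822) : Slade2017_thm141 :=
  Slade2017_thm141_of_criticalCurve (Slade2017_criticalCurve_of_prop822 h)

end LongRangePhi4

/-- The barrier `RigorousRGSmallParameter` (= Slade's Theorem 1.4.1, first display, `n ≥ 1`)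
follows from Proposition 8.2.2 as printed (finite-volume limits along the critical curve,
`LongRangePhi4.Slade2017_prop822`) by real analysis alone: the limit/derivative interchange
(this file) and §8.3 (sibling files). [cite: Slade2017, §8.2–§8.3] -/
theorem rigorousRGSmallParameter_of_prop822 (h : LongRangePhi4.Slade2017_prop822) :
    RigorousRGSmallParameter :=
  rigorousRGSmallParameter_of_criticalCurve (LongRangePhi4.Slade2017_criticalCurve_of_prop822 h)

/-! ### Fact decomposition record (librarian `fact-decompose`, 2026-08-16) -/

/-- **Assembly of the split of the barrier `RigorousRGSmallParameter`** (budget-capped fact;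
human ruling 2026-08-16). The barrier is literally Slade's Theorem 1.4.1
(`rigorousRGSmallParameter_iff : RigorousRGSmallParameter ↔ LongRangePhi4.Slade2017_thm141`), and
along the printed proof (§8.3 "Proof of Theorem 1.4.1" from Theorem 8.3.1, and §8.2) the tree
proves it from ONE named leaf, Proposition 8.2.2 as printed (`LongRangePhi4.Slade2017_prop822`,
this file: the finite-volume limits along the critical curve — the output of the
renormalisation-group flow of §5–§8.1). That leaf is the single child of the split; the glue is
`rigorousRGSmallParameter_of_prop822`. The child is itself theory-sized (Lemma 8.2.1 fed with
`Z_N = e^{-u_N|Λ|}(I_N + K_N)` and the flow estimates, Theorems 6.3.1, 7.2.2, 7.3.1,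
Lemmas 8.1.1–8.1.4, on [BS-rg-IV, BS-rg-V, BS-rg-step]); its own decomposition needs the
renormalisation-group coordinates, which the sibling files `RigorousRGSmallParameterFlow*.lean`
have begun to provide (`Slade2017_prop822_exponent_of_flow`).
[cite: Slade2017, Theorem 1.4.1; §8.2 Proposition 8.2.2; §8.3 Theorem 8.3.1 and "Proof of Theorem 1.4.1"] -/
theorem RigorousRGSmallParameter_holds_of :
    LongRangePhi4.Slade2017_prop822 → RigorousRGSmallParameter :=
  fun h => rigorousRGSmallParameter_of_prop822 h

end Literature.Barriers.CriticalPhenomena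

end
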